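import Summits.QuantumFields.YangMills.Theorems.BalabanUVNodesK1WindowKOfRunRowsSurvivors
import Summits.QuantumFields.YangMills.Theorems.BalabanUVNodesK1NodeOLadderRunwiseEdges

/-!
# Crux K1⁸ ∕ K2⁸ — THE END-MINIMAL β-SIDE LETTERS: {RUNS OF EVERY LENGTH IN EVERY SMALL WINDOW, [III] (2.6)'s LAST MEMBER ALONG THE RUNS, (C)} ⟹ `EndpointExistence`;
# NO β-bound of any kind (uniform, per-level, run-wise) and NO partial-sum floor is read; on forward-generated halting currying constructions the
# window-runs letter is NECESSARY, so under (C) + no-shrink the END is EQUIVALENT to it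

Cell `pub-ymgap`, YM-PLAN Track A (HUMAN RULING D-0062 ∕ D-0149, director-ym №197 ∕ №207), WIDTH SEAT `pub-ymgap-dag-n13-w4` (g6) on NODE n13 [Balaban1989LargeFieldII]; helper
(`--supports stmt-QuantumFields-26907 --as helper`, count-neutral) for the deciding crux K1⁸ `StabilityBRunRowsAtRecordR13SepCoPH` = stmt-QuantumFields-26907 (route rev 26ᴿ ∕ 27), on the
side of its born-closed partner K2⁸ `EndpointGivenRunRowsR13SepCoPH` = stmt-QuantumFields-26908 (the END road).  Eleventh module of the seat's window ∕ survivor ∕ END lineage; sibling of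
file 10 `…K1EndOfRunRowsNoShrinkSurvCont` (p617600: rows (i) + no-shrink + (C) ⟹ END through PER-LEVEL bounds), which is NOT imported here (cited by name only).

AUTHORSHIP ∕ ATTRIBUTION.  §1 is a PORT WITH ATTRIBUTION of ym-nodeO-ideate seat IDEA-4 g12's crux workfile `Cruxes/EndpointGivenBR13SepCoPH/Idea4g12EndExactRowsSketch.lean`
(sha16 0aa51fa03f1a7a72, §2 «THE CEILING IS NOT LOAD-BEARING FOR THE END», decls `seed_of_windowRun` ∕ `run_dichotomy_of_seed` ∕ `exists_extension_of_survCont`, kernel-clean there, «never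
imported by the tree»; a planner seat files nothing under `Theorems/`).  §4's `windowRuns_of_runwiseCeiling` and `endpointExistence_of_windowRuns_runwisePS_survCont` are IDEA-4 g12's STATEMENTS
(:234 ∕ :219), the latter re-derived here through the no-shrink rung.  The rung «(iv) ↦ (2.6)'s last member» is ym-nodeO P3 g53's (n°92; tree port = file 10).  §2–§3 (the join and the
exactness) are this seat's; everything rests on pub-balaban-gaps' shooting ∕ Tietze ∕ foliation roads (`Gaps.EndRunwiseShooting`, `Gaps.EndSurvivorExtension`, `Gaps.EndContAlongFoliation`) BY NAME.

THE POINT.  In the shooting proof of the END ([I] Thm 2 p. 259, first sentence: every small renormalised `g` is the endpoint `g_K` of an in-window run, for every `K`) a β-CEILING is consumed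
at exactly one place — to produce a SEED, i.e. some in-window run of length `K` ending at or below the target (Gaps' `seed_of_upper`) — and a β-FLOOR at exactly one place — to exclude the
«touching» alternative of the intermediate-value dichotomy (a run that sits at the top `γ` of the window at some step and ends below the target).  IDEA-4 g12: a run of length `K` INSIDE
`]0, g]` IS a seed for the target `g` (§1), so «runs of every length in every small window» replaces every ceiling.  P3 g53 ∕ file 10: the touching alternative is excluded by the NO-SHRINK
letter `g_m ≤ (1+β₀)·g_{n′}` ([III] (2.6), last member, along the in-window runs) as soon as the target is `≤ γ∕(1+β₀)` — no partial sums.  JOINED (§2): {ALL-K WINDOW RUNS at every level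
`≤ γ₀` (run currency `RGEqH K β gs ∧ Step.InInterval γ K gs`), NO-(1+β₀)⁻¹-SHRINK on `]0, γ′]`, (C)} ⟹ `EndpointExistence C` for every forward-generated `C`, reading NO bound on β whatsoever
and NO (PS).  EXACTNESS (§3): on a forward-generated, halting, currying construction (the three modelling clauses of `FlowStepRuns`, met by `modelOf β`) the END IMPLIES the window-runs
letter (its own endpoint runs solve (0.20), `FlowStepRuns.rgEqH_of_inInterval`), so GIVEN (C) and no-shrink the END is EQUIVALENT to «runs of every length in every small window» — the
K1 side's ALL-K window (this lineage's files 8∕9: row (i) ⟹ K-uniform window ⟹ survivors) is exactly the ceiling-side content the END needs, and K1⁷'s displayed WEAK window («some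
K ≥ 1») is not (IDEA-4 g12 §4 `betaKill2`, cited).  §4: every END road of the lineage factors through §2 — rows (i) give the window runs (file 8), (PS) gives no-shrink on a shrunk level
(dag-n24-w1's `exists_noShrink_of_psFloor`).  §5: the datum-level twin and K2⁸'s shape with the rows conjunct replaced by {all-K window runs, no-shrink, (C)} (texts inline) hold outright.

WHAT THIS FILE PROVES (theorems only; 0 `def`, 0 `sorry`, standard axioms; generic `β : HBeta`, level `γ`).
* §1 (IDEA-4 g12 port) `seed_of_windowRun` · `run_dichotomy_of_seed` · `exists_extension_of_survCont` (Tietze in the bare coupling, UNBOUNDED).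
* §2 ★ `couplingTrajectory_exists_of_windowRuns_noShrink` · ★★ `endpointExistence_of_windowRuns_noShrink_betaContH` · ★★★ `endpointExistence_of_windowRuns_noShrink_survCont`.
* §3 `windowRuns_of_endpointExistence` · ★ `endpointExistence_iff_windowRuns_of_noShrink_survCont` · `endpointExistence_modelOf_iff_windowRuns_of_noShrink`.
* §4 `windowRuns_of_runwiseCeiling` · `windowRuns_of_runConstRemainder` · `endpointExistence_of_runConstRemainder_noShrink_survCont_via_windowRuns` · `endpointExistence_of_windowRuns_runwisePS_survCont`.
* §5 `endpointExistence_datumOfRecord₁₃SepCoPH_of_windowRuns_noShrink_survCont` (general `N`) · `endpointExistence_datumOfRecord₁₃SepCoPH_of_windowRowsNoShrink` (`N = 2`, inline) ·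
  `windowRowsNoShrink_of_runRowsPS` (the pressed K1⁸ rows (i)+(iv)+(C) ⟹ these rows).

HONEST SCOPE.  [folklore] real analysis on the recursion (0.20) over the tree's carriers; every β-side letter (window runs, no-shrink, (C), rows, floors) is a HYPOTHESIS SHAPE inhabited
at NO θ here (NODE O: [I] Thm 2 p. 259 ∕ Thm 3 p. 264, [III] (2.6); continuity in the coupling asserted in [I] §1 pp. 263–264 without located proof); nothing of Bałaban asserted; nothing
about `Node00.betaOfRecord₁₃` proved; NOT a proof of `stub_nodes13PWS`, `stub_runRows13PWS`, `stub_cont13` or any K2 stub; K1⁸ NOT closed; N13 NOT discharged; counts unmoved (typed 28∕28 ·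
discharged 5∕27 · A 5∕28).  One finite four-torus programme at fixed `ε = L^{−K}`, Bałaban AS PRINTED; the Yang–Mills mass gap (Clay) is NOT proved by any of this — route R4 closes the
conditional finite-𝕋⁴ rung `BalabanLadder.UV` only; nothing continuum ∕ ℝ⁴ ∕ OS.  No `def`, no `instance`, no `notation`, no `axiom`.
References (context only): [I] = [Balaban1987RG1] CMP **109** (1987): (0.17)–(0.20) pp. 255–256, Thm 2 p. 259, §1 pp. 263–264, (1.20)–(1.22) + Thm 3 p. 264, (5.10) p. 293;
[III] = [Balaban1988Convergent] CMP **119** (1988): (2.6) p. 255; [V] = [Balaban1989LargeFieldII] CMP **122** (1989): Thm 1 + (0.1) pp. 355–356.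
-/

noncomputable section

open scoped BigOperators Matrix.Norms.L2Operator

namespace Summit.QuantumFields.YangMills.Theorems.BalabanUVNodesK1EndOfWindowRunsNoShrinkSurvCont

open Literature.MathematicalPhysics.QuantumFieldTheory.Balaban1983to89
open Literature.MathematicalPhysics.QuantumFieldTheory.Balaban1983to89.FlowStep
open Literature.MathematicalPhysics.QuantumFieldTheory.Balaban1983to89.FlowStepRuns
open Literature.MathematicalPhysics.QuantumFieldTheory.Balaban1983to89.DagBinding
open Literature.MathematicalPhysics.QuantumFieldTheory.Balaban1983to89.T4Continuum (T4Family FiniteEpsData)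
open Summit.QuantumFields.YangMills.Theorems.BalabanUVNodesK2NamedJetsRunRemAt (Survivors RunConstRemainder SurvCont run_of_survivor)
open Summit.QuantumFields.YangMills.Theorems.K1V6Defs (Window)
open Summit.QuantumFields.YangMills.Theorems.BalabanUVNodesK1WindowKOfRunRows (runwiseCeiling_of_runConstRemainder windowK_uniform_of_forwardGenerated_of_runwiseCeiling)
open Summit.QuantumFields.BalabanUV.Gaps.EndSurvivorExtension (extH extH_apply betaContH_extH rgEqH_extH_of_rgEqH rgEqH_of_rgEqH_extH isClosed_survivors)
open Summit.QuantumFields.BalabanUV.Gaps.EndRunwiseShooting (shooting_dichotomy inInterval_shoot rgEqH_shoot_of_survives shoot_eq_of_Y_eq shoot_eq_top_of_Y_eq windowSum_shoot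
  Y_eq_of_run survives_of_run)
open Summit.QuantumFields.BalabanUV.Gaps.EndContAlongFoliation (endpointExistence_of_runs)
open Summit.QuantumFields.YangMills.Theorems.K1NodeOLadderRunwiseEdges (exists_noShrink_of_psFloor noShrink_mono_level)

/-! ## §1 Seeds from window runs; the dichotomy with the seed as hypothesis; Tietze unbounded (IDEA-4 g12 §2, ported with attribution) -/

section Seeds

variable {β : HBeta} {γ : ℝ}

/-- **A RUN OF LENGTH `K` INSIDE `]0, g]` IS A SEED for the target `g` at every level `γ ≥ g`**: its initial coupling `x_s := g_0 ∈ ]0, g]` has a clamped level-`γ` trajectory that IS the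
run (`EndRunwiseShooting.Y_eq_of_run`), hence survives to `K` in `]0, γ]` and ends at or below `g` (`1∕g² ≤ 1∕g_K² = Y_K(x_s)`).  This is the ONLY thing `EndRunwiseShooting.seed_of_upper`
produced from the ceiling `β ≤ β′`.  IDEA-4 g12 :128, ported. [cite: Balaban1987RG1, (0.17)–(0.20) pp.255–256 (elementary)] -/
theorem seed_of_windowRun {K : ℕ} {g : ℝ} (hgγ : g ≤ γ) {gs : ℕ → ℝ} (hrg : RGEqH K β gs) (hI : Step.InInterval g K gs) :
    ∃ xs : ℝ, 0 < xs ∧ xs ≤ g ∧ (∀ k, k ≤ K → 1 / γ ^ 2 ≤ Y β γ k xs) ∧ 1 / g ^ 2 ≤ Y β γ K xs := by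
  have hIγ : Step.InInterval γ K gs := fun k hk => ⟨(hI k hk).1, (hI k hk).2.trans hgγ⟩
  refine ⟨gs 0, (hI 0 (Nat.zero_le _)).1, (hI 0 (Nat.zero_le _)).2, survives_of_run hrg hIγ, ?_⟩
  rw [(Y_eq_of_run (γ := γ) hrg hIγ K le_rfl).1]
  exact one_div_le_one_div_of_le (pow_pos (hI K le_rfl).1 2) (pow_le_pow_left₀ (hI K le_rfl).1.le (hI K le_rfl).2 2)

/-- `EndRunwiseShooting.run_dichotomy` WITH THE SEED AS HYPOTHESIS (no `β ≤ β′`): `β` continuous on the boxes `]0,γ]^{k+1}`, a seed for `(K, g)`; EITHER an in-interval solution of (0.20) of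
length `K` ends exactly at `g`, OR one sits at `γ` at some step `k ≤ K`, ends strictly below `g`, and its window sum `Σ_{j∈[k,K)} β_j` is `< 1∕γ² − 1∕g²`.  Proof = the tree's, after its
first line (`shooting_dichotomy` BY NAME).  IDEA-4 g12 :138, ported. [cite: Balaban1987RG1, Thm 2 p.259 (first sentence), (0.20) p.256 (elementary)] -/
theorem run_dichotomy_of_seed (hγ : 0 < γ) (hcont : BetaContH γ β) (K : ℕ) {g : ℝ} (hg : 0 < g) (hgγ : g ≤ γ)
    {xs : ℝ} (hxs : 0 < xs) (hxsg : xs ≤ g) (hsv : ∀ k, k ≤ K → 1 / γ ^ 2 ≤ Y β γ k xs) (hendK : 1 / g ^ 2 ≤ Y β γ K xs) :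
    (∃ gs : ℕ → ℝ, gs K = g ∧ RGEqH K β gs ∧ Step.InInterval γ K gs) ∨
    (∃ gs : ℕ → ℝ, RGEqH K β gs ∧ Step.InInterval γ K gs ∧ gs K < g ∧ ∃ k, k ≤ K ∧ gs k = γ ∧
        ∑ j ∈ Finset.Ico k K, β j (prefixOf gs j) < 1 / γ ^ 2 - 1 / g ^ 2) := by
  rcases shooting_dichotomy hγ hcont hxs (hxsg.trans hgγ) ⟨hsv, hendK⟩ with
    ⟨x, -, -, hsurv, hY⟩ | ⟨x, -, -, hsurv, hlt, k, hk, hYk⟩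
  · exact Or.inl ⟨fun k => gClamp γ (Y β γ k x), shoot_eq_of_Y_eq hg hY (hsurv K le_rfl),
      rgEqH_shoot_of_survives hγ hsurv, inInterval_shoot hγ K x⟩
  · right
    refine ⟨fun k => gClamp γ (Y β γ k x), rgEqH_shoot_of_survives hγ hsurv, inInterval_shoot hγ K x, ?_, k, hk,
      shoot_eq_top_of_Y_eq hγ hYk, ?_⟩
    · have hYK : 1 / (gClamp γ (Y β γ K x)) ^ 2 = Y β γ K x := inv_sq_gClamp hγ (hsurv K le_rfl)
      have hpos : 0 < gClamp γ (Y β γ K x) := gClamp_pos hγ _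
      by_contra hge
      have hge' : g ≤ gClamp γ (Y β γ K x) := not_lt.mp hge
      have : 1 / (gClamp γ (Y β γ K x)) ^ 2 ≤ 1 / g ^ 2 :=
        one_div_le_one_div_of_le (by positivity) (pow_le_pow_left₀ hg.le hge' 2)
      linarith
    · rw [windowSum_shoot k K hk x, hYk]
      linarith

/-- **TIETZE IN THE BARE COUPLING, UNBOUNDED**: if every trace `x ↦ β_k(clampPrefix β γ₀ k x)` is continuous on its survivor set `S_k` (relatively closed in the normal space `]0, γ₀]`,
`EndSurvivorExtension.isClosed_survivors`), there is a table `F` of functions continuous on ALL of `]0, γ₀]` agreeing with the traces on the survivor sets — Mathlib's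
`ContinuousMap.exists_restrict_eq` (real-valued Tietze, no bound asked, none delivered).  Gaps' `exists_extension_of_survivorLetters` minus its bound letter.  IDEA-4 g12 :93, ported. [folklore] -/
theorem exists_extension_of_survCont {γ₀ : ℝ}
    (hsc : ∀ k : ℕ, ContinuousOn (fun x : ℝ => β k (clampPrefix β γ₀ k x)) {x : ℝ | 0 < x ∧ x ≤ γ₀ ∧ ∀ j, j ≤ k → 1 / γ₀ ^ 2 ≤ Y β γ₀ j x}) :
    ∃ F : ℕ → ℝ → ℝ, (∀ k : ℕ, ContinuousOn (F k) (Set.Ioc 0 γ₀)) ∧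
      ∀ (k : ℕ) (x : ℝ), 0 < x → x ≤ γ₀ → (∀ j, j ≤ k → 1 / γ₀ ^ 2 ≤ Y β γ₀ j x) → F k x = β k (clampPrefix β γ₀ k x) := by
  have key : ∀ k : ℕ, ∃ Fk : ℝ → ℝ, ContinuousOn Fk (Set.Ioc 0 γ₀) ∧
      ∀ x : ℝ, 0 < x → x ≤ γ₀ → (∀ j, j ≤ k → 1 / γ₀ ^ 2 ≤ Y β γ₀ j x) → Fk x = β k (clampPrefix β γ₀ k x) := by
    intro k
    let s : Set (Set.Ioc (0 : ℝ) γ₀) := {p | ∀ j, j ≤ k → 1 / γ₀ ^ 2 ≤ Y β γ₀ j p.1}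
    have hs : IsClosed s := isClosed_survivors hsc k
    have hf : Continuous fun q : s => β k (clampPrefix β γ₀ k q.1.1) :=
      (hsc k).comp_continuous (continuous_subtype_val.comp continuous_subtype_val) fun q => ⟨q.1.2.1, q.1.2.2, q.2⟩
    let f : C(s, ℝ) := ⟨fun q => β k (clampPrefix β γ₀ k q.1.1), hf⟩
    have hfq : ∀ q : s, f q = β k (clampPrefix β γ₀ k q.1.1) := fun q => rfl
    obtain ⟨g, hgf⟩ := ContinuousMap.exists_restrict_eq hs f
    refine ⟨fun x => if h : 0 < x ∧ x ≤ γ₀ then g ⟨x, h⟩ else 0, ?_, ?_⟩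
    · rw [continuousOn_iff_continuous_restrict]
      have e : (Set.Ioc (0 : ℝ) γ₀).restrict (fun x => if h : 0 < x ∧ x ≤ γ₀ then g ⟨x, h⟩ else 0) = g := by
        funext p
        have hp : 0 < (p : ℝ) ∧ (p : ℝ) ≤ γ₀ := p.2
        simp only [Set.restrict_apply, dif_pos hp, Subtype.coe_eta]
      rw [e]
      exact g.continuous
    · intro x hx hxγ hsurv
      have h : 0 < x ∧ x ≤ γ₀ := ⟨hx, hxγ⟩
      simp only [dif_pos h]
      have := congrArg (fun φ : C(s, ℝ) => φ ⟨⟨x, h⟩, hsurv⟩) hgf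
      simpa [hfq] using this
  choose F hF using key
  exact ⟨F, fun k => (hF k).1, fun k => (hF k).2⟩

end Seeds

/-! ## §2 THE JOIN: window-run seeds + the no-shrink exclusion of the touching alternative ⟹ the END, reading no bound on β and no floor -/

section Join

variable {β : HBeta}

/-- **★ RUN-WISE SUFFICIENCY WITHOUT A CEILING AND WITHOUT (PS)**: `β` continuous on the boxes `]0,γ]^{k+1}`, RUNS OF EVERY LENGTH INSIDE `]0, g]` FOR EVERY `g ∈ ]0, γ]` (run currency),
and NO-(1+β₀)⁻¹-SHRINK along the in-`]0,γ]` runs (`g_m ≤ (1+β₀)·g_{n′}`, `m < n′ ≤ n`; `0 ≤ β₀`) ⟹ for every `K` and every target `g ∈ ]0, γ∕(1+β₀)]` an in-interval run of (0.20) of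
length `K` ends EXACTLY at `g_K = g`: the touching alternative of §1's dichotomy sits at `γ` at a step `k ≤ K` and ends at `g_K < g ≤ γ∕(1+β₀)`, which no-shrink forbids for `k < K`
(`γ = g_k ≤ (1+β₀) g_K < γ`) and which is absurd for `k = K` (`γ = g_K < g ≤ γ`).  Compare `EndRunwiseShooting.couplingTrajectory_exists_of_topRuns` (ceiling for the seed, top-run threshold in
the `M`-form) and IDEA-4 g12's `couplingTrajectory_exists_of_windowRuns_runwisePS` (window-run seed, (PS) floor). [cite: Balaban1987RG1, Thm 2 p.259 (first sentence), (0.20) p.256; Balaban1988Convergent, (2.6) p.255 (elementary consequence; nothing of the theorems asserted)] -/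
theorem couplingTrajectory_exists_of_windowRuns_noShrink (β : HBeta) {γ β₀ : ℝ} (hγ : 0 < γ) (hβ₀ : 0 ≤ β₀) (hcont : BetaContH γ β)
    (hwin : ∀ g : ℝ, 0 < g → g ≤ γ → ∀ K : ℕ, ∃ gs : ℕ → ℝ, RGEqH K β gs ∧ Step.InInterval g K gs)
    (hns : ∀ (n : ℕ) (gs : ℕ → ℝ), RGEqH n β gs → Step.InInterval γ n gs → ∀ m n', m < n' → n' ≤ n → gs m ≤ (1 + β₀) * gs n') :
    ∀ (K : ℕ) (g : ℝ), 0 < g → g ≤ γ / (1 + β₀) → ∃ gs : ℕ → ℝ, gs K = g ∧ RGEqH K β gs ∧ Step.InInterval γ K gs := by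
  intro K g hg hgle
  have h1 : (0 : ℝ) < 1 + β₀ := by linarith
  have hγdiv : γ / (1 + β₀) ≤ γ := div_le_self hγ.le (by linarith)
  have hgγ : g ≤ γ := hgle.trans hγdiv
  obtain ⟨gs₀, hrg₀, hI₀⟩ := hwin g hg hgγ K
  obtain ⟨xs, hxs, hxsg, hsv, hendK⟩ := seed_of_windowRun (β := β) (γ := γ) hgγ hrg₀ hI₀
  rcases run_dichotomy_of_seed hγ hcont K hg hgγ hxs hxsg hsv hendK with h | ⟨gs, hrg, hI, hlt, k, hk, hgk, -⟩
  · exact h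
  · exfalso
    rcases lt_or_eq_of_le hk with hkK | rfl
    · -- the run sits at `γ` at step `k < K` and ends below `g ≤ γ/(1+β₀)`: forbidden by no-shrink
      have hmul : gs k ≤ (1 + β₀) * gs K := hns K gs hrg hI k K hkK le_rfl
      have h2 : (1 + β₀) * gs K < (1 + β₀) * g := mul_lt_mul_of_pos_left hlt h1
      have h3 : (1 + β₀) * g ≤ γ := by
        have := (le_div_iff₀ h1).1 hgle
        linarith [mul_comm g (1 + β₀)]
      linarith
    · -- the run sits at `γ` at the LAST step and ends below `g ≤ γ`: absurd
      linarith

/-- **★★ THE END FROM WINDOW RUNS + NO-SHRINK, BOX-CONTINUITY FORM** (every forward-generated `C`): `β` continuous on the boxes `]0,γ₀]^{k+1}`, runs of EVERY length inside EVERY window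
`]0, γ]`, `γ ≤ γ₀` (run currency), and no-(1+β₀)⁻¹-shrink along the in-`]0,γ′]` runs for some `0 < γ′ ≤ γ₀`, `0 ≤ β₀` ⟹ `DagBinding.EndpointExistence C`, with `γ₂ := γ′` and
`g⋆(γ) := γ∕(1+β₀)`.  NO bound on β (uniform, per-level or run-wise) and NO partial-sum floor is read.  Assembly = Gaps' (`couplingTrajectory…` + forward uniqueness
`FlowStepRuns.flow_eq_of_rgEqH`). [cite: Balaban1987RG1, Thm 2 p.259 (first sentence), (0.17)–(0.20) pp.255–256; Balaban1988Convergent, (2.6) p.255 (elementary consequence; nothing of the theorems asserted)] -/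
theorem endpointExistence_of_windowRuns_noShrink_betaContH {C : B12.Construction} (hgen : ForwardGenerated C β) {γ₀ γ' β₀ : ℝ} (hγ' : 0 < γ') (hγ'le : γ' ≤ γ₀)
    (hcont : BetaContH γ₀ β)
    (hwin : ∀ γ : ℝ, 0 < γ → γ ≤ γ₀ → ∀ K : ℕ, ∃ gs : ℕ → ℝ, RGEqH K β gs ∧ Step.InInterval γ K gs) (hβ₀ : 0 ≤ β₀)
    (hns : ∀ (n : ℕ) (gs : ℕ → ℝ), RGEqH n β gs → Step.InInterval γ' n gs → ∀ m n', m < n' → n' ≤ n → gs m ≤ (1 + β₀) * gs n') :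
    EndpointExistence C := by
  intro m
  refine ⟨γ', hγ', fun γ hγ hγle => ?_⟩
  have h1 : (0 : ℝ) < 1 + β₀ := by linarith
  refine ⟨γ / (1 + β₀), div_pos hγ h1, fun g hg hgle K => ?_⟩
  have hγ₀le : γ ≤ γ₀ := hγle.trans hγ'le
  have hcontγ : BetaContH γ β := fun k => (hcont k).mono (box_mono hγ₀le k)
  have hwinγ : ∀ g' : ℝ, 0 < g' → g' ≤ γ → ∀ K : ℕ, ∃ gs : ℕ → ℝ, RGEqH K β gs ∧ Step.InInterval g' K gs :=
    fun g' hg' hg'le K => hwin g' hg' (hg'le.trans hγ₀le) K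
  obtain ⟨gs, hgsK, hrg, hI⟩ :=
    couplingTrajectory_exists_of_windowRuns_noShrink β hγ hβ₀ hcontγ hwinγ (noShrink_mono_level hγle hns) K g hg hgle
  have heq : ∀ k, k ≤ K → (C ⟨K, m, gs 0⟩).flow.g k = gs k :=
    flow_eq_of_rgEqH (C ⟨K, m, gs 0⟩).flow β K (fun k hk => hgen.2 ⟨K, m, gs 0⟩ k hk) (hgen.1 ⟨K, m, gs 0⟩) hrg (fun k hk => (hI k hk).1)
  refine ⟨gs 0, fun k hk => ?_, ?_⟩
  · rw [heq k hk]; exact hI k hk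
  · rw [heq K le_rfl]; exact hgsK

/-- **★★★ THE END-MINIMAL β-SIDE LETTERS, SURVIVOR FORM** (every forward-generated `C`): {RUNS OF EVERY LENGTH IN EVERY WINDOW `]0, γ]`, `γ ≤ γ₀` (run currency); NO-(1+β₀)⁻¹-SHRINK along the
in-`]0,γ′]` runs, `0 < γ′ ≤ γ₀`, `0 ≤ β₀` ([III] (2.6), last member); (C) survivor continuity `SurvCont β γ₀`} ⟹ `DagBinding.EndpointExistence C`.  NO β-bound of any kind, NO (PS), NO
remainder ∕ drift ∕ anchor.  Proof: Tietze WITHOUT bounds (§1) gives a table `F` continuous on `]0,γ₀]` agreeing with the traces on the survivor sets; `extH F` has THE SAME in-window runs at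
every level `≤ γ₀` (`rgEqH_extH_of_rgEqH` ∕ `rgEqH_of_rgEqH_extH`), so the window runs and the no-shrink letter transfer to it; the box form gives the END of `modelOf (extH F)`, and
`EndContAlongFoliation.endpointExistence_of_runs` carries it to `C`.  Compare file 10's `endpointExistence_of_runConstRemainder_noShrink_survCont` (row (i) for PER-LEVEL seeds) and IDEA-4
g12's `endpointExistence_of_windowRuns_runwisePS_survCont` ((PS) for the exclusion): each keeps one letter this theorem drops.
[cite: Balaban1987RG1, Thm 2 p.259 (first sentence), (0.17)–(0.20) pp.255–256, §1 pp.263–264; Balaban1988Convergent, (2.6) p.255 (elementary consequence; nothing of the theorems asserted)] -/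
theorem endpointExistence_of_windowRuns_noShrink_survCont {C : B12.Construction} (hgen : ForwardGenerated C β) {γ₀ γ' β₀ : ℝ} (hγ₀ : 0 < γ₀) (hγ' : 0 < γ')
    (hγ'le : γ' ≤ γ₀)
    (hwin : ∀ γ : ℝ, 0 < γ → γ ≤ γ₀ → ∀ K : ℕ, ∃ gs : ℕ → ℝ, RGEqH K β gs ∧ Step.InInterval γ K gs) (hβ₀ : 0 ≤ β₀)
    (hns : ∀ (n : ℕ) (gs : ℕ → ℝ), RGEqH n β gs → Step.InInterval γ' n gs → ∀ m n', m < n' → n' ≤ n → gs m ≤ (1 + β₀) * gs n')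
    (hsc : SurvCont β γ₀) : EndpointExistence C := by
  obtain ⟨F, hFc, hagree⟩ := exists_extension_of_survCont hsc
  have hwin' : ∀ γ : ℝ, 0 < γ → γ ≤ γ₀ → ∀ K : ℕ, ∃ gs : ℕ → ℝ, RGEqH K (extH F) gs ∧ Step.InInterval γ K gs := by
    intro γ hγ hγle K
    obtain ⟨gs, hrg, hI⟩ := hwin γ hγ hγle K
    exact ⟨gs, rgEqH_extH_of_rgEqH hγle hagree hrg hI, hI⟩
  have hns' : ∀ (n : ℕ) (gs : ℕ → ℝ), RGEqH n (extH F) gs → Step.InInterval γ' n gs → ∀ m n', m < n' → n' ≤ n → gs m ≤ (1 + β₀) * gs n' :=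
    fun n gs hrg hI m n' hmn hn' => hns n gs (rgEqH_of_rgEqH_extH hγ'le hagree hrg hI) hI m n' hmn hn'
  exact endpointExistence_of_runs hγ₀ (modelOf_forwardGenerated _) (modelOf_haltsOutside _) (modelOf_curries _) hgen
    (fun _ _ hγle _ _ hI hrg => rgEqH_of_rgEqH_extH hγle hagree hrg hI)
    (endpointExistence_of_windowRuns_noShrink_betaContH (modelOf_forwardGenerated (extH F)) hγ' hγ'le (betaContH_extH hFc) hwin' hβ₀ hns')

end Join

/-! ## §3 EXACTNESS ON THE CEILING SIDE: the END implies the window-runs letter; under (C) + no-shrink the END is equivalent to it -/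

section Exact

variable {β : HBeta}

/-- **THE WINDOW-RUNS LETTER IS NECESSARY FOR THE END** (forward-generated, halting, currying constructions — `FlowStepRuns`' three modelling clauses, all met by `modelOf β`): the END's own
endpoint runs stay in the window and SOLVE (0.20) (`FlowStepRuns.rgEqH_of_inInterval`), so below the END's `γ₂` every window `]0, γ]` carries runs of every length `K` (take any admissible
target, e.g. `min g⋆ γ`). [cite: Balaban1987RG1, Thm 2 p.259 (first sentence), (0.20) p.256 (bookkeeping)] -/
theorem windowRuns_of_endpointExistence {C : B12.Construction} (hgen : ForwardGenerated C β) (hhalt : HaltsOutside C β) (hcur : CurriesHBeta C β)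
    (hE : EndpointExistence C) :
    ∃ γ₂ : ℝ, 0 < γ₂ ∧ ∀ γ : ℝ, 0 < γ → γ ≤ γ₂ → ∀ K : ℕ, ∃ gs : ℕ → ℝ, RGEqH K β gs ∧ Step.InInterval γ K gs := by
  obtain ⟨γ₂, hγ₂, H⟩ := hE 0
  refine ⟨γ₂, hγ₂, fun γ hγ hγle K => ?_⟩
  obtain ⟨gstar, hgstar, Hg⟩ := H γ hγ hγle
  obtain ⟨g0, hI, -⟩ := Hg (min gstar γ) (lt_min hgstar hγ) (min_le_left _ _) K
  exact ⟨(C ⟨K, 0, g0⟩).flow.g, rgEqH_of_inInterval hgen hhalt hcur ⟨K, 0, g0⟩ hI, hI⟩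

/-- **★ THE END ⟺ RUNS OF EVERY LENGTH IN EVERY SMALL WINDOW, GIVEN (C) AND NO-SHRINK** (forward-generated, halting, currying `C`; (C) `SurvCont β γ₀` and no-(1+β₀)⁻¹-shrink on `]0,γ′]`,
`0 < γ′ ≤ γ₀`, `0 ≤ β₀`): `EndpointExistence C ↔ ∃ γ₂ > 0, ∀ γ ∈ ]0,γ₂], ∀ K, ∃ in-]0,γ] solution of (0.20) of length K`.  (⟹ §3 necessity, no letter read; ⟸ §2 at the levels
`≤ min γ₂ γ′`, with (C) and no-shrink restricted there — `SurvCont` is used at `γ₀` through Tietze and the runs below `min γ₂ γ′ ≤ γ₀`.)  So, floor side at rung (2.6) and (C) given,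
the ceiling-side content of [I] Thm 2's first sentence is EXACTLY the all-K window. [cite: Balaban1987RG1, Thm 2 p.259 (first sentence), (0.17)–(0.20) pp.255–256; Balaban1988Convergent, (2.6) p.255] -/
theorem endpointExistence_iff_windowRuns_of_noShrink_survCont {C : B12.Construction} (hgen : ForwardGenerated C β) (hhalt : HaltsOutside C β)
    (hcur : CurriesHBeta C β) {γ₀ γ' β₀ : ℝ} (hγ₀ : 0 < γ₀) (hγ' : 0 < γ') (hγ'le : γ' ≤ γ₀) (hβ₀ : 0 ≤ β₀)
    (hns : ∀ (n : ℕ) (gs : ℕ → ℝ), RGEqH n β gs → Step.InInterval γ' n gs → ∀ m n', m < n' → n' ≤ n → gs m ≤ (1 + β₀) * gs n')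
    (hsc : SurvCont β γ₀) :
    EndpointExistence C ↔
      ∃ γ₂ : ℝ, 0 < γ₂ ∧ ∀ γ : ℝ, 0 < γ → γ ≤ γ₂ → ∀ K : ℕ, ∃ gs : ℕ → ℝ, RGEqH K β gs ∧ Step.InInterval γ K gs := by
  refine ⟨windowRuns_of_endpointExistence hgen hhalt hcur, fun ⟨γ₂, hγ₂, hwin⟩ => ?_⟩
  -- Tietze at `γ₀` (hsc); then the BOX form for `extH F` at the level `γ₁ := min γ₂ γ′ ≤ γ₀` (continuity by restriction, window runs and no-shrink below `γ₁`); transfer to `C`.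
  obtain ⟨F, hFc, hagree⟩ := exists_extension_of_survCont hsc
  set γ₁ : ℝ := min γ₂ γ' with hγ₁
  have hγ₁pos : 0 < γ₁ := lt_min hγ₂ hγ'
  have hγ₁le₀ : γ₁ ≤ γ₀ := (min_le_right _ _).trans hγ'le
  have hwin' : ∀ γ : ℝ, 0 < γ → γ ≤ γ₁ → ∀ K : ℕ, ∃ gs : ℕ → ℝ, RGEqH K (extH F) gs ∧ Step.InInterval γ K gs := by
    intro γ hγ hγle K
    obtain ⟨gs, hrg, hI⟩ := hwin γ hγ (hγle.trans (min_le_left _ _)) K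
    exact ⟨gs, rgEqH_extH_of_rgEqH (hγle.trans hγ₁le₀) hagree hrg hI, hI⟩
  have hns' : ∀ (n : ℕ) (gs : ℕ → ℝ), RGEqH n (extH F) gs → Step.InInterval γ₁ n gs → ∀ m n', m < n' → n' ≤ n → gs m ≤ (1 + β₀) * gs n' :=
    fun n gs hrg hI m n' hmn hn' =>
      noShrink_mono_level (min_le_right γ₂ γ') hns n gs (rgEqH_of_rgEqH_extH hγ₁le₀ hagree hrg hI) hI m n' hmn hn'
  have hcont₁ : BetaContH γ₁ (extH F) := fun k => (betaContH_extH hFc k).mono (box_mono hγ₁le₀ k)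
  exact endpointExistence_of_runs hγ₀ (modelOf_forwardGenerated _) (modelOf_haltsOutside _) (modelOf_curries _) hgen
    (fun _ _ hγle _ _ hI hrg => rgEqH_of_rgEqH_extH hγle hagree hrg hI)
    (endpointExistence_of_windowRuns_noShrink_betaContH (modelOf_forwardGenerated (extH F)) hγ₁pos le_rfl hcont₁ hwin' hβ₀ hns')

/-- The same at the CANONICAL CONSTRUCTION `modelOf β` (its three modelling clauses hold by construction), box-continuity form: for `β` continuous on the boxes `]0,γ₀]^{k+1}` with no-shrink
on `]0,γ′]`, `EndpointExistence (modelOf β) ↔` runs of every length in every small window. [cite: Balaban1987RG1, Thm 2 p.259 (first sentence), (0.17)–(0.20) pp.255–256; Balaban1988Convergent, (2.6) p.255] -/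
theorem endpointExistence_modelOf_iff_windowRuns_of_noShrink (β : HBeta) {γ₀ γ' β₀ : ℝ} (hγ₀ : 0 < γ₀) (hγ' : 0 < γ') (hγ'le : γ' ≤ γ₀) (hβ₀ : 0 ≤ β₀)
    (hcont : BetaContH γ₀ β)
    (hns : ∀ (n : ℕ) (gs : ℕ → ℝ), RGEqH n β gs → Step.InInterval γ' n gs → ∀ m n', m < n' → n' ≤ n → gs m ≤ (1 + β₀) * gs n') :
    EndpointExistence (modelOf β) ↔
      ∃ γ₂ : ℝ, 0 < γ₂ ∧ ∀ γ : ℝ, 0 < γ → γ ≤ γ₂ → ∀ K : ℕ, ∃ gs : ℕ → ℝ, RGEqH K β gs ∧ Step.InInterval γ K gs :=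
  endpointExistence_iff_windowRuns_of_noShrink_survCont (modelOf_forwardGenerated β) (modelOf_haltsOutside β) (modelOf_curries β) hγ₀ hγ' hγ'le hβ₀ hns
    (SurvCont.of_betaContH hγ₀ hcont)

end Exact

/-! ## §4 FACTORINGS: every END road of the lineage goes through §2 — row (i) ∕ a run-wise ceiling give the window runs, (PS) gives no-shrink on a shrunk level -/

section Factorings

variable {β : HBeta}

/-- **A RUN-WISE PER-LEVEL CEILING ⟹ THE WINDOW RUNS** (run currency), read back from the canonical construction `modelOf β` (this lineage's file 8
`…K1WindowKOfRunRows.windowK_uniform_of_forwardGenerated_of_runwiseCeiling`): for every `γ ∈ ]0, γ₀]` and every `K` an in-`]0,γ]` solution of (0.20) of length `K`.  IDEA-4 g12 :234's statement.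
[cite: Balaban1987RG1, (0.17)–(0.20) pp.255–256 and Thm 3 p.264 (elementary consequence)] -/
theorem windowRuns_of_runwiseCeiling {u : ℕ → ℝ} {γ₀ : ℝ}
    (hup : ∀ (n : ℕ) (gs : ℕ → ℝ), RGEqH n β gs → Step.InInterval γ₀ n gs → ∀ k, k ≤ n → β k (prefixOf gs k) ≤ u k) :
    ∀ γ : ℝ, 0 < γ → γ ≤ γ₀ → ∀ K : ℕ, ∃ gs : ℕ → ℝ, RGEqH K β gs ∧ Step.InInterval γ K gs := by
  intro γ hγ hγle K
  obtain ⟨g0, -, hI, hrg⟩ := windowK_uniform_of_forwardGenerated_of_runwiseCeiling (modelOf β) β (modelOf_forwardGenerated β) hup γ hγ hγle K 0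
  exact ⟨((modelOf β) ⟨K, 0, g0⟩).flow.g, hrg, hI⟩

/-- **ROW (i) ⟹ THE WINDOW RUNS**: DEF-1's run-wise constant remainder `RunConstRemainder β b r γ₀` (ANY `b`, `r`) is a run-wise per-level ceiling `b_k + r` (file 8's
`runwiseCeiling_of_runConstRemainder`), hence gives runs of every length in every window `]0,γ]`, `γ ≤ γ₀`. [cite: Balaban1987RG1, Thm 3 p.264, (1.20)–(1.22) p.264, (0.20) p.256 (elementary consequence)] -/
theorem windowRuns_of_runConstRemainder {b : ℕ → ℝ} {r γ₀ : ℝ} (hrem : RunConstRemainder β b r γ₀) :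
    ∀ γ : ℝ, 0 < γ → γ ≤ γ₀ → ∀ K : ℕ, ∃ gs : ℕ → ℝ, RGEqH K β gs ∧ Step.InInterval γ K gs :=
  windowRuns_of_runwiseCeiling (runwiseCeiling_of_runConstRemainder hrem)

/-- **FILE 10's ROAD THROUGH §2**: rows (i) + no-shrink + (C) ⟹ END, re-derived with row (i) read ONLY as a producer of window runs (no per-level bound reaches the shooting).  Same statement as
`…K1EndOfRunRowsNoShrinkSurvCont.endpointExistence_of_runConstRemainder_noShrink_survCont` (p617600), different road. [cite: Balaban1987RG1, Thm 2 p.259 (first sentence), Thm 3 p.264; Balaban1988Convergent, (2.6) p.255] -/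
theorem endpointExistence_of_runConstRemainder_noShrink_survCont_via_windowRuns {C : B12.Construction} (hgen : ForwardGenerated C β) {b : ℕ → ℝ} {r γ₀ γ' β₀ : ℝ}
    (hγ₀ : 0 < γ₀) (hrem : RunConstRemainder β b r γ₀) (hγ' : 0 < γ') (hγ'le : γ' ≤ γ₀) (hβ₀ : 0 ≤ β₀)
    (hns : ∀ (n : ℕ) (gs : ℕ → ℝ), RGEqH n β gs → Step.InInterval γ' n gs → ∀ m n', m < n' → n' ≤ n → gs m ≤ (1 + β₀) * gs n')
    (hsc : SurvCont β γ₀) : EndpointExistence C :=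
  endpointExistence_of_windowRuns_noShrink_survCont hgen hγ₀ hγ' hγ'le (windowRuns_of_runConstRemainder hrem) hβ₀ hns hsc

/-- **IDEA-4 g12's CEILING-FREE (PS) ROAD AS A COROLLARY** (its `endpointExistence_of_windowRuns_runwisePS_survCont`, :219): window runs at every level `≤ γ₀` + the run-wise partial-sum floor
`−M` at level `γ₀` + (C) ⟹ END — the floor gives no-halving on a shrunk level `γ′ ≤ γ₀` (dag-n24-w1's `exists_noShrink_of_psFloor`, `β₀ := 1`), then §2.
[cite: Balaban1987RG1, Thm 2 p.259 (first sentence), (0.20) p.256, (5.10) p.293; Balaban1988Convergent, (2.6) p.255] -/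
theorem endpointExistence_of_windowRuns_runwisePS_survCont {C : B12.Construction} (hgen : ForwardGenerated C β) {γ₀ M : ℝ} (hγ₀ : 0 < γ₀)
    (hwin : ∀ γ : ℝ, 0 < γ → γ ≤ γ₀ → ∀ K : ℕ, ∃ gs : ℕ → ℝ, RGEqH K β gs ∧ Step.InInterval γ K gs)
    (hps : ∀ (n : ℕ) (gs : ℕ → ℝ), RGEqH n β gs → Step.InInterval γ₀ n gs → ∀ k, k ≤ n → -M ≤ ∑ j ∈ Finset.Ico k n, β j (prefixOf gs j))
    (hsc : SurvCont β γ₀) : EndpointExistence C := by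
  obtain ⟨γ', hγ', hγ'le, hns⟩ := exists_noShrink_of_psFloor one_pos hγ₀ hps
  exact endpointExistence_of_windowRuns_noShrink_survCont hgen hγ₀ hγ' hγ'le hwin zero_le_one hns hsc

end Factorings

/-! ## §5 At NODE 00's record datum (general `N`); K2⁸'s shape with the rows conjunct replaced by the END-minimal letters (`N = 2`, texts inline) -/

section Datum

variable {F : T4Family} {N : ℕ} [NeZero N]

/-- **END AT THE RECORD DATUM FROM THE END-MINIMAL LETTERS OF THE β OF RECORD** (`betaOfRecord₁₃ F N θ.toStage13Params` = the datum's `βfun`, `rfl`; forward generation = the datum's field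
`fwd`): window runs at every level `≤ γ₀`, no-shrink on `]0,γ′]`, (C) at `γ₀` ⟹ `EndpointExistence (datum).C.toB12`.  CONDITIONAL; no item closed.
[cite: Balaban1987RG1, Thm 2 p.259 (first sentence), (0.17)–(0.20) pp.255–256, §1 pp.263–264; Balaban1988Convergent, (2.6) p.255; Balaban1989LargeFieldII, Thm 1 + (0.1) pp.355–356] -/
theorem endpointExistence_datumOfRecord₁₃SepCoPH_of_windowRuns_noShrink_survCont (θ : Node00.Stage13HParams F N) (h : θ.Provisos₁₃SepCoPH F N)
    {γ₀ γ' β₀ : ℝ} (hγ₀ : 0 < γ₀) (hγ' : 0 < γ') (hγ'le : γ' ≤ γ₀)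
    (hwin : ∀ γ : ℝ, 0 < γ → γ ≤ γ₀ → ∀ K : ℕ, ∃ gs : ℕ → ℝ, RGEqH K (Node00.betaOfRecord₁₃ F N θ.toStage13Params) gs ∧ Step.InInterval γ K gs) (hβ₀ : 0 ≤ β₀)
    (hns : ∀ (n : ℕ) (gs : ℕ → ℝ), RGEqH n (Node00.betaOfRecord₁₃ F N θ.toStage13Params) gs → Step.InInterval γ' n gs →
      ∀ m n', m < n' → n' ≤ n → gs m ≤ (1 + β₀) * gs n')
    (hsc : SurvCont (Node00.betaOfRecord₁₃ F N θ.toStage13Params) γ₀) :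
    EndpointExistence (Node00.datumOfRecord₁₃SepCoPH F N θ h).C.toB12 :=
  endpointExistence_of_windowRuns_noShrink_survCont (Node00.datumOfRecord₁₃SepCoPH F N θ h).fwd hγ₀ hγ' hγ'le hwin hβ₀ hns hsc

/-- **K2⁸'s SHAPE WITH THE END-MINIMAL ROWS HOLDS OUTRIGHT** (texts inline; `N = 2`): at every Stage-13 tuple `θ` with provisos `h` — unity ∧ slots, admissibility, (B) at the datum and the
K1 window conjunct being UNREAD, as in K2⁸'s closer — the rows «∃ γ₀ γ′ β₀, 0 < γ′ ≤ γ₀ ∧ 0 ≤ β₀ ∧ (W) runs of every length in every window `]0,γ]`, `γ ≤ γ₀` ∧ no-shrink on `]0,γ′]` ∧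
(C) `SurvCont β_θ γ₀`» give `EndpointExistence (datum).C.toB12`.  CONDITIONAL on the displayed rows; no item closed.
[cite: Balaban1987RG1, Thm 2 p.259 (first sentence), (0.20) p.256; Balaban1988Convergent, (2.6) p.255] -/
theorem endpointExistence_datumOfRecord₁₃SepCoPH_of_windowRowsNoShrink :
    ∀ (F : T4Family) (θ : Node00.Stage13HParams F 2) (h : θ.Provisos₁₃SepCoPH F 2), (θ.ZhUnity F 2 ∧ θ.SlotsNondegenerate₁₃ F 2) → θ.Admissible F 2 →
      B16.EndStatementBPrinted (Node00.datumOfRecord₁₃SepCoPH F 2 θ h).C →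
      (∃ γ₀ γ' β₀ : ℝ, 0 < γ' ∧ γ' ≤ γ₀ ∧ 0 ≤ β₀ ∧
        (∀ γ : ℝ, 0 < γ → γ ≤ γ₀ → ∀ K : ℕ, ∃ gs : ℕ → ℝ, RGEqH K (Node00.betaOfRecord₁₃ F 2 θ.toStage13Params) gs ∧ Step.InInterval γ K gs) ∧
        (∀ (n : ℕ) (gs : ℕ → ℝ), RGEqH n (Node00.betaOfRecord₁₃ F 2 θ.toStage13Params) gs → Step.InInterval γ' n gs →
          ∀ m n', m < n' → n' ≤ n → gs m ≤ (1 + β₀) * gs n') ∧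
        SurvCont (Node00.betaOfRecord₁₃ F 2 θ.toStage13Params) γ₀) →
      Window (Node00.datumOfRecord₁₃SepCoPH F 2 θ h) →
      EndpointExistence (Node00.datumOfRecord₁₃SepCoPH F 2 θ h).C.toB12 := by
  intro F θ h _hU _hθ _hB hrows _hwin
  obtain ⟨γ₀, γ', β₀, hγ', hγ'le, hβ₀, hwin, hns, hsc⟩ := hrows
  exact endpointExistence_datumOfRecord₁₃SepCoPH_of_windowRuns_noShrink_survCont θ h (hγ'.trans_le hγ'le) hγ' hγ'le hwin hβ₀ hns hsc

/-- **THE PRESSED K1⁸ ROWS CONJUNCT ⟹ THE END-MINIMAL ROWS** (texts inline): rows (i)+(iv)+(C) at level `γ₀` give the window runs at every level `≤ γ₀` (§4, row (i)), no-halving on a shrunk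
level (dag-n24-w1's edge, `β₀ := 1`) and (C) unchanged — so every supplier of the pressed rows at a tuple also supplies §5's antecedent, and `closes` could be re-threaded through
`endpointExistence_datumOfRecord₁₃SepCoPH_of_windowRowsNoShrink` with no new mathematics. [cite: Balaban1987RG1, Thm 3 p.264, (0.20) p.256, (5.10) p.293; Balaban1988Convergent, (2.6) p.255] -/
theorem windowRowsNoShrink_of_runRowsPS {F : T4Family} {θ : Node00.Stage13HParams F 2}
    (hrows : ∃ (b : ℕ → ℝ) (r γ₀ M : ℝ), 0 < γ₀ ∧ RunConstRemainder (Node00.betaOfRecord₁₃ F 2 θ.toStage13Params) b r γ₀ ∧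
      (∀ (n : ℕ) (gs : ℕ → ℝ), RGEqH n (Node00.betaOfRecord₁₃ F 2 θ.toStage13Params) gs → Step.InInterval γ₀ n gs →
        ∀ k, k ≤ n → -M ≤ ∑ j ∈ Finset.Ico k n, Node00.betaOfRecord₁₃ F 2 θ.toStage13Params j (prefixOf gs j)) ∧
      SurvCont (Node00.betaOfRecord₁₃ F 2 θ.toStage13Params) γ₀) :
    ∃ γ₀ γ' β₀ : ℝ, 0 < γ' ∧ γ' ≤ γ₀ ∧ 0 ≤ β₀ ∧
      (∀ γ : ℝ, 0 < γ → γ ≤ γ₀ → ∀ K : ℕ, ∃ gs : ℕ → ℝ, RGEqH K (Node00.betaOfRecord₁₃ F 2 θ.toStage13Params) gs ∧ Step.InInterval γ K gs) ∧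
      (∀ (n : ℕ) (gs : ℕ → ℝ), RGEqH n (Node00.betaOfRecord₁₃ F 2 θ.toStage13Params) gs → Step.InInterval γ' n gs →
        ∀ m n', m < n' → n' ≤ n → gs m ≤ (1 + β₀) * gs n') ∧
      SurvCont (Node00.betaOfRecord₁₃ F 2 θ.toStage13Params) γ₀ := by
  obtain ⟨b, r, γ₀, M, hγ₀, hrem, hps, hsc⟩ := hrows
  obtain ⟨γ', hγ', hγ'le, hns⟩ := exists_noShrink_of_psFloor one_pos hγ₀ hps
  exact ⟨γ₀, γ', 1, hγ', hγ'le, zero_le_one, windowRuns_of_runConstRemainder hrem, hns, hsc⟩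

end Datum

end Summit.QuantumFields.YangMills.Theorems.BalabanUVNodesK1EndOfWindowRunsNoShrinkSurvCont

end
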